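import Summits.ResolutionOfSingularities.ResolutionOfSingularities.Theses.IndSmooth
import Literature.AlgebraicGeometry.Resolution.RegularLocalRingsQuotient
import HarnessLib

/-!
# Slicing a local regular chart by a kernel element outside `𝔪²`
# (stmt-ResolutionOfSingularities-16088, line `birth`, stub `stub_sliceChart`)

Route `ResolutionOfSingularities/IndSmooth`, crux #3 `SmoothToUniformizing` ("ind-smooth valuation
rings ⇒ relative local uniformization"), skeleton v5 (local regular charts).

A **local regular chart** of `R ⊆ O ⊆ K` (`O` a valuation ring of the field `K`, `R` a
`k`-subalgebra of `K`) is a regular local `k`-algebra `L`, essentially of finite type, with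
`k`-algebra maps `ψ : R → L`, `χ : L → K` such that `χ(L) ⊆ O`, `χ⁻¹(𝔪_O) = 𝔪_L` and
`χ ∘ ψ =` the inclusion `R ⊆ K`.

`stub_sliceChart` is the SLICE step of the dichotomy "every local regular chart refines to an
injective or a stuck one": if `g ∈ ker χ` lies outside `𝔪_L²`, then `L' := L/(g)` is again a local
regular chart of `R`, and its embedding dimension is one less.

Proof. `χ g = 0` has valuation `0 < 1`, so `g ∈ 𝔪_L` by the chart condition. By Matsumura's
Thm. 14.2 (tree lemma `IsRegularLocalRing.quotient_span_singleton`), `L/(g)` is a regular local ring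
and `emb dim L/(g) + 1 = emb dim L`
(`IsRegularLocalRing.spanFinrank_maximalIdeal_quotient_span_singleton`). A quotient of an
essentially-of-finite-type algebra is essentially of finite type. Since `χ` kills `(g)` it factors
through `χ' : L/(g) → K`, still with values in `O`, and `ψ' := (L → L/(g)) ∘ ψ` still composes with
`χ'` to the inclusion. Finally the quotient map `L → L/(g)` is a surjection of local rings, hence a
local homomorphism, so `𝔪_{L/(g)}` pulls back to `𝔪_L` and the chart condition
`χ'⁻¹(𝔪_O) = 𝔪_{L/(g)}` is inherited from `L`.

References: H. Matsumura, *Commutative Ring Theory*, CUP 1986, Thm. 14.2.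
-/

noncomputable section

-- single-problem summit: the doubled namespace component `ResolutionOfSingularities` is forced
set_option linter.dupNamespace false

open IsLocalRing
open Literature.AlgebraicGeometry.Resolution (IsRegularLocalRing.quotient_span_singleton
  IsRegularLocalRing.spanFinrank_maximalIdeal_quotient_span_singleton)

namespace Summit.ResolutionOfSingularities.ResolutionOfSingularities.Theorems.IndSmoothBirth

/-- In a local chart (`χ⁻¹(𝔪_O) = 𝔪_L`, stated through the valuation of `O`) every kernel
element of `χ` lies in the maximal ideal: `v(χ g) = v(0) = 0 < 1`. [folklore] -/
theorem sliceChart_mem_maximalIdeal_of_eq_zero {K : Type} [Field K] (O : ValuationSubring K)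
    {L F : Type} [CommRing L] [IsLocalRing L] [FunLike F L K] [ZeroHomClass F L K] (χ : F)
    (hloc : ∀ x : L, x ∈ maximalIdeal L ↔ O.valuation (χ x) < 1) {g : L} (hg : χ g = 0) :
    g ∈ maximalIdeal L := by
  rw [hloc, hg, map_zero]
  exact zero_lt_one

/-- The quotient map of a local ring onto a non-trivial quotient reflects the maximal ideal:
`a mod I ∈ 𝔪_{L/I} ↔ a ∈ 𝔪_L` (a surjection of local rings is a local homomorphism). [folklore] -/
theorem sliceChart_mk_mem_maximalIdeal_iff {L : Type} [CommRing L] [IsLocalRing L] (I : Ideal L)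
    [IsLocalRing (L ⧸ I)] (a : L) :
    Ideal.Quotient.mk I a ∈ maximalIdeal (L ⧸ I) ↔ a ∈ maximalIdeal L := by
  haveI := IsLocalHom.of_surjective (Ideal.Quotient.mk I) Ideal.Quotient.mk_surjective
  rw [← Ideal.mem_comap, IsLocalRing.maximalIdeal_comap]

/-- **Stub `stub_sliceChart` (Matsumura, Thm. 14.2).** Slicing a local regular chart
`R →ψ L →χ K` of `R ⊆ O ⊆ K` by a kernel element `g ∈ ker χ ∖ 𝔪_L²`: `L' = L/(g)` is a regular
local `k`-algebra essentially of finite type, `χ` factors through `χ' : L' → K` (as `χ g = 0`) with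
values in `O`, `ψ' = (L → L') ∘ ψ` composes with `χ'` to the inclusion, `χ'⁻¹(𝔪_O) = 𝔪_{L'}`, and
the embedding dimension drops by exactly one:
`emb dim L' + 1 = emb dim L`. [cite: Matsumura1987, Thm. 14.2] -/
theorem stub_sliceChart (k K : Type) [Field k] [Field K] [Algebra k K] (O : ValuationSubring K)
    (R : Subalgebra k K) (L : Type) [CommRing L] [IsRegularLocalRing L] [Algebra k L]
    [Algebra.EssFiniteType k L] (ψ : R →ₐ[k] L) (χ : L →ₐ[k] K) (hχO : ∀ x : L, χ x ∈ O)
    (hloc : ∀ x : L, x ∈ maximalIdeal L ↔ O.valuation (χ x) < 1)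
    (hψχ : ∀ r : R, χ (ψ r) = (r : K)) (g : L) (hg : χ g = 0)
    (hg2 : g ∉ (maximalIdeal L) ^ 2) :
    ∃ (L' : Type) (_ : CommRing L') (_ : IsRegularLocalRing L') (_ : Algebra k L')
      (_ : Algebra.EssFiniteType k L') (ψ' : R →ₐ[k] L') (χ' : L' →ₐ[k] K),
      (∀ x : L', χ' x ∈ O) ∧ (∀ x : L', x ∈ maximalIdeal L' ↔ O.valuation (χ' x) < 1) ∧
        (∀ r : R, χ' (ψ' r) = (r : K)) ∧
        (maximalIdeal L').spanFinrank + 1 = (maximalIdeal L).spanFinrank := by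
  -- `g ∈ 𝔪_L` since `v(χ g) = v 0 = 0 < 1`
  have hg1 : g ∈ maximalIdeal L := sliceChart_mem_maximalIdeal_of_eq_zero O χ hloc hg
  -- Matsumura 14.2: `L/(g)` is regular local, of embedding dimension one less
  haveI hreg : IsRegularLocalRing (L ⧸ Ideal.span {g}) :=
    (IsRegularLocalRing.quotient_span_singleton hg1 hg2).1
  -- `χ` kills `(g)`
  have hχI : ∀ a : L, a ∈ Ideal.span {g} → χ a = 0 := fun a ha => by
    obtain ⟨b, rfl⟩ := Ideal.mem_span_singleton'.mp ha
    rw [map_mul, hg, mul_zero]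
  refine ⟨L ⧸ Ideal.span {g}, inferInstance, hreg, inferInstance, inferInstance,
    (Ideal.Quotient.mkₐ k (Ideal.span {g})).comp ψ, Ideal.Quotient.liftₐ (Ideal.span {g}) χ hχI,
    ?_, ?_, ?_, IsRegularLocalRing.spanFinrank_maximalIdeal_quotient_span_singleton hg1 hg2⟩
  · -- values in `O`
    intro x
    obtain ⟨a, rfl⟩ := Ideal.Quotient.mk_surjective x
    rw [Ideal.Quotient.liftₐ_apply, Ideal.Quotient.lift_mk]
    exact hχO a
  · -- the chart condition `χ'⁻¹(𝔪_O) = 𝔪_{L/(g)}`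
    intro x
    obtain ⟨a, rfl⟩ := Ideal.Quotient.mk_surjective x
    rw [sliceChart_mk_mem_maximalIdeal_iff, Ideal.Quotient.liftₐ_apply, Ideal.Quotient.lift_mk]
    exact hloc a
  · -- `χ' ∘ ψ' = ` the inclusion
    intro r
    rw [AlgHom.comp_apply, Ideal.Quotient.mkₐ_eq_mk, Ideal.Quotient.liftₐ_apply,
      Ideal.Quotient.lift_mk]
    exact hψχ r

end Summit.ResolutionOfSingularities.ResolutionOfSingularities.Theorems.IndSmoothBirth
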